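import Literature.MathematicalPhysics.QuantumFieldTheory.BalabanImbrieJaffe1984to88.BIJ88Expansion5143GkBound
import Literature.MathematicalPhysics.QuantumFieldTheory.BalabanImbrieJaffe1984to88.BIJ88Sect5StatementsPart4

/-!
# `BalabanImbrieJaffe1984to88.BIJ88Ineq312Instance` — T. Bałaban, J. Imbrie, A. Jaffe, *Effective action and cluster properties of the abelian
Higgs model*, Commun. Math. Phys. **114** (1988) 257–315 [BalabanImbrieJaffe1988]: Sect. 5.14, p. 312 [PDF 56] — **the `|G_k(X)|` estimate IN THE
PRINTED PRODUCT FORM** `c(F(X)) · (vertex factor)^{β″|X∖∪X_c|} · Π_{X_{σ₁}⊂X}[c_{σ₁}]` for the observable-carrying gas of (5.14.3) (gen 11/12), i.e. an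
INSTANCE of the typed leaf `BIJ88Sect5StatementsPart4.Ineq312` with the vacuum smallness from (5.14.4).

p. 312 [PDF 56], verbatim: *"These considerations lead to the following estimate: |G_k(X)| ≤ c(F(X)) (e^β(L^kε/ε₀)^{1/4−α})^{β′|X∖∪X_c|}
Π_{X_{σ₁}⊂X: dist(X_{σ₁},Λ^{(k)c}_{12}) < r(e_k)} [c(L^kε)^{−m(c)}e^{−m′(c)}]."* and *"The main source of concern in estimating G_k(X_{r′}) is that we
only have bounds |F_{k,loc}(X_{σ₁})| ≤ c(L^kε)^{−m(c)}e^{−m′(c)} …"*.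

HONEST FRAMING (cell `lit-balaban`, verbatim): statement-level skeleton of published theorems with citation tags; proofs where landed; nothing here is a claim about the Yang–Mills mass gap.

PDF held: `paper:balaban1988-cmp114-bij-abelian-higgs-effective-action` (journal page = PDF page + 256); p. 312 = PDF 56, read this session.

WHAT IS REPRODUCED (unit `lit-balaban-p25`, generation 12 of the Phase-2 proof seat p25; SKELETON row `C2.Claim@312`, head = the typed leaf `Ineq312`;
HOME `run/shared/lean/pub/lit-balaban/lit-balaban-p25/`). Setting of gen 12's `BIJ88Expansion5143GkBound` (the (5.14.3) gas of gen 11: polymers = nonempty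
cube sets of `W`, virtual supports, vacuum activities `w`, observable activities `wQ` on the slot-carrying polymers `obsPolys W loc K`; genuine cubes
`T(X′) = {v ∈ X′ : v.isLeft}`; slot cubes `K.image (locv loc)`).
* §1 BOOKKEEPING: `disjoint_slotsIn_of_disjoint_cvsupp`, **`prod_prod_slotsIn_eq`** (for an admissible decorated family `D` — pairwise disjoint virtual
  supports, carrying exactly the slots located in `X′` — the observable constants factor out: `Π_{X∈D}Π_{j∈H(X)} c_j = Π_{j∈obsIn X′} c_j`),
  **`card_free_le`** (*"|X∖∪X_c|"*: the genuine non-slot cubes of `X′` number at most the uncovered genuine cubes plus `Σ_{X∈D}|X∖H(X)|`).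
* §2 **`norm_Gk_le_printed`**: vacuum activities vanishing off connected polymers with `‖w X‖ ≤ θ^{β′#X}`, observable activities with
  `‖wQ X‖ ≤ (Π_{j∈H(X)} c_j)·θ^{β′|X∖H(X)|}` (`c_j ≥ 0` the observable constants, `H(X) = slotsIn loc K X`), `0 < θ ≤ 1`, `0 ≤ β″ ≤ β′`,
  `2(Δ+1)²e^{a₀}θ^{β′−β″} ≤ a₀ ≤ 1/2` ⟹
  `‖G_k(X′)‖ ≤ [e^{2a₀#T}·N_D(X′)] · θ^{β″·#(T ∖ slot cubes)} · Π_{j∈obsIn X′} c_j`, `N_D(X′)` = the number of admissible decorated families in `X′`.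
* §3 **`ineq312_instance`**: the same AS AN INSTANCE OF THE TYPED LEAF `BIJ88Sect5StatementsPart4.Ineq312 (cubeSys (ι ⊕ (Finset ι × Finset ι))) Gk cF obsProd
  nfree θ β″` with `Gk X′ := ‖G_k(X′)‖`, `cF X′ := e^{2a₀#T(X′)}·N_D(X′)`, `obsProd X′ := Π_{j∈obsIn X′} c_j`, `nfree X′ := #(T(X′) ∖ slot cubes)`;
  **`ineq312_of_ineq5144`**: for REAL corner data every input from the typed leaf (5.14.4) `Ineq5144` BY NAME (then `c_j = θ`: in the leaf's currency a
  slot is a `d/dt`-derivative and carries a small factor).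
HONEST SCOPE: (a) `cF X′ = e^{2a₀#T}·N_D(X′)` depends on `X′` through the number of its genuine cubes and of its admissible decorated families — the
print's `c(F(X))` is not quantified; (b) the observable bound is a HYPOTHESIS shaped after *"|F_{k,loc}(X_{σ₁})| ≤ c(L^kε)^{−m(c)}e^{−m′(c)}"* with a
small factor per non-slot cube (the p. 312 integrations by parts that produce those small factors are not modelled); (c) (5.14.4) is NOT proved;
(d) the boundary refinement and the restriction *"dist(X_{σ₁}, Λ₁₂^{(k)c}) < r(e_k)"* in the product are not modelled (all located slots enter);
(e) constants are not the printed ones. 0 `sorry`, 0 new `Prop` facts (D-0026); theorems only; imports `BIJ88Expansion5143GkBound`,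
`BIJ88Sect5StatementsPart4`; modifies nothing. NOT summit progress; NOT continuum; NOT Clay. Cell `lit-balaban` Phase 2, seat p25 gen 12 (row owner
r16, referee ref-5).
-/

noncomputable section

open Finset
open Literature.Probability.LatticeModels
open Literature.MathematicalPhysics.QuantumFieldTheory.BalabanImbrieJaffe1984to88.BIJ88VirtualSupports310
open Literature.MathematicalPhysics.QuantumFieldTheory.BalabanImbrieJaffe1984to88.BIJ88Expansion5143
open Literature.MathematicalPhysics.QuantumFieldTheory.BalabanImbrieJaffe1984to88.BIJ88Expansion5143Ordered
open Literature.MathematicalPhysics.QuantumFieldTheory.BalabanImbrieJaffe1984to88.BIJ88ObservableGas312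
open Literature.MathematicalPhysics.QuantumFieldTheory.BalabanImbrieJaffe1984to88.BIJ88ClusterSupports312
open Literature.MathematicalPhysics.QuantumFieldTheory.BalabanImbrieJaffe1984to88.BIJ88SupportRegrouping312
open Literature.MathematicalPhysics.QuantumFieldTheory.BalabanImbrieJaffe1984to88.BIJ88ObservableFactorization312
open Literature.MathematicalPhysics.QuantumFieldTheory.BalabanImbrieJaffe1984to88.BIJ88Expansion5143Obs
open Literature.MathematicalPhysics.QuantumFieldTheory.BalabanImbrieJaffe1984to88.BIJ88Expansion5143KP
open Literature.MathematicalPhysics.QuantumFieldTheory.BalabanImbrieJaffe1984to88.BIJ88Expansion5143GkBound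
open Literature.MathematicalPhysics.QuantumFieldTheory.BalabanImbrieJaffe1984to88.BIJ88Ineq5113Covering (cubeSys)

namespace Literature.MathematicalPhysics.QuantumFieldTheory.BalabanImbrieJaffe1984to88.BIJ88Ineq312Instance

/-! ## §1 Bookkeeping: observable constants factor out; the free genuine cubes are covered -/

section Comb

variable {ι : Type*} [DecidableEq ι] {S : Type*} [DecidableEq S] {adj : ι → ι → Prop} [DecidableRel adj] {W : Finset ι} {loc : S → ι}
  {K : Finset S}

omit [DecidableEq S] in
/-- polymers with disjoint virtual supports carry disjoint slot sets. [cite: BalabanImbrieJaffe1988, p.309 (Sect. 5.14)] -/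
theorem disjoint_slotsIn_of_disjoint_cvsupp {X X₂ : Finset ι} (h : Disjoint (cvsupp adj W X) (cvsupp adj W X₂)) :
    Disjoint (slotsIn loc K X) (slotsIn loc K X₂) :=
  disjoint_left.2 fun _ hj hj₂ => disjoint_left.1 h (inl_mem_vsupp_iff.2 (mem_slotsIn.1 hj).2) (inl_mem_vsupp_iff.2 (mem_slotsIn.1 hj₂).2)

/-- **the observable constants factor out of an admissible decorated family**: for `D` with pairwise disjoint virtual supports carrying exactly
the slots located in `X′`, `Π_{X∈D} Π_{j∈H(X)} c_j = Π_{j ∈ obsIn X′} c_j` (p. 312: the product *"Π_{X_{σ₁}⊂X}[…]"* over the observables in `X`).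
[cite: BalabanImbrieJaffe1988, (5.14.5) p.312] -/
theorem prod_prod_slotsIn_eq {D : Finset (Finset ι)} (hdisj : ∀ X ∈ D, ∀ X₂ ∈ D, X ≠ X₂ → Disjoint (cvsupp adj W X) (cvsupp adj W X₂))
    {X' : Finset (ι ⊕ (Finset ι × Finset ι))} (hcov : D.biUnion (slotsIn loc K) = obsIn (locv1 loc) K X') (c : S → ℝ) :
    ∏ X ∈ D, ∏ j ∈ slotsIn loc K X, c j = ∏ j ∈ obsIn (locv1 loc) K X', c j := by
  rw [← hcov, prod_biUnion]
  exact fun X hX X₂ hX₂ hne => disjoint_slotsIn_of_disjoint_cvsupp (hdisj X hX X₂ hX₂ hne)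

omit [DecidableEq S] in
/-- **`|X ∖ ∪X_c|` IS COVERED**: the genuine cubes of `X′` that are not slot cubes number at most the genuine cubes of `X′` outside the decorated
polymers plus `Σ_{X∈D} |X ∖ H(X)|` (the non-slot cubes of the decorated polymers). [cite: BalabanImbrieJaffe1988, (5.14.5) p.312] -/
theorem card_free_le (D : Finset (Finset ι)) (X' : Finset (ι ⊕ (Finset ι × Finset ι))) :
    ((X'.filter fun v => v.isLeft) \ K.image (locv loc)).card ≤
      ((X' \ dsupp (cvsupp adj W) D) ∩ X'.filter fun v => v.isLeft).card + ∑ X ∈ D, (X \ (slotsIn loc K X).image loc).card := by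
  set T : Finset (ι ⊕ (Finset ι × Finset ι)) := X'.filter fun v => v.isLeft with hT
  have hsub : T \ K.image (locv loc) ⊆
      ((X' \ dsupp (cvsupp adj W) D) ∩ T) ∪ D.biUnion fun X => ((X \ (slotsIn loc K X).image loc).image Sum.inl) := by
    intro v hv
    obtain ⟨hvT, hvK⟩ := mem_sdiff.1 hv
    have hvX' : v ∈ X' := (mem_filter.1 hvT).1
    by_cases hvd : v ∈ dsupp (cvsupp adj W) D
    · obtain ⟨X, hX, hvX⟩ := mem_dsupp.1 hvd
      obtain ⟨c, rfl⟩ := Sum.isLeft_iff.1 (mem_filter.1 hvT).2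
      have hcX : c ∈ X := inl_mem_vsupp_iff.1 hvX
      refine mem_union.2 (Or.inr (mem_biUnion.2 ⟨X, hX, mem_image.2 ⟨c, mem_sdiff.2 ⟨hcX, fun hc => hvK ?_⟩, rfl⟩⟩))
      obtain ⟨j, hj, hjc⟩ := mem_image.1 hc
      exact mem_image.2 ⟨j, (mem_slotsIn.1 hj).1, by simp only [locv, hjc]⟩
    · exact mem_union.2 (Or.inl (mem_inter.2 ⟨mem_sdiff.2 ⟨hvX', hvd⟩, hvT⟩))
  calc (T \ K.image (locv loc)).card
      ≤ (((X' \ dsupp (cvsupp adj W) D) ∩ T) ∪ D.biUnion fun X => ((X \ (slotsIn loc K X).image loc).image Sum.inl)).card := card_le_card hsub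
    _ ≤ ((X' \ dsupp (cvsupp adj W) D) ∩ T).card + (D.biUnion fun X => ((X \ (slotsIn loc K X).image loc).image Sum.inl)).card :=
        card_union_le _ _
    _ ≤ ((X' \ dsupp (cvsupp adj W) D) ∩ T).card +
          ∑ X ∈ D, (((X \ (slotsIn loc K X).image loc).image (Sum.inl : ι → ι ⊕ (Finset ι × Finset ι))).card) := by
        gcongr
        exact card_biUnion_le
    _ ≤ ((X' \ dsupp (cvsupp adj W) D) ∩ T).card + ∑ X ∈ D, (X \ (slotsIn loc K X).image loc).card := by
        gcongr with X
        exact card_image_le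

end Comb

/-! ## §2 The printed product form -/

section Main

variable {ι : Type*} [DecidableEq ι] [Fintype ι] {S : Type*} [DecidableEq S] {adj : ι → ι → Prop} [DecidableRel adj] {nbr : ι → Finset ι}
  {Δ : ℕ} {W : Finset ι} {loc : S → ι} {K : Finset S}

/-- **`|G_k(X)| ≤ c(F(X)) · θ^{β″|X∖∪X_c|} · Π_{X_{σ₁}⊂X}[c_{σ₁}]` FOR THE GAS OF (5.14.3)**: vacuum activities vanishing off the connected polymers with
`‖w X‖ ≤ θ^{β′#X}`; observable activities with `‖wQ X‖ ≤ (Π_{j∈H(X)} c_j)·θ^{β′|X∖H(X)|}` on the slot-carrying polymers (`c_j ≥ 0`,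
`H(X) = slotsIn loc K X`, `|X∖H(X)| = #(X ∖ H(X).image loc)`); `0 < θ ≤ 1`, `0 ≤ β″ ≤ β′`, `2(Δ+1)²e^{a₀}θ^{β′−β″} ≤ a₀ ≤ 1/2` (abutting relation
symmetric of degree `≤ Δ`). Then
`‖G_k(X′)‖ ≤ [e^{2a₀#T}·N_D(X′)] · θ^{β″·#(T ∖ slot cubes)} · Π_{j∈obsIn X′} c_j`,
`T` = the genuine cubes of `X′`, `N_D(X′)` = the number of admissible decorated families in `X′`. [cite: BalabanImbrieJaffe1988, (5.14.5) p.312] -/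
theorem norm_Gk_le_printed (hR : ∀ x y, adj x y → adj y x) (hΔ : ∀ x, (nbr x).card ≤ Δ) (hnbr : ∀ x y, adj x y → y ∈ nbr x)
    {θ β' β'' a₀ : ℝ} (hθ0 : 0 < θ) (hθ1 : θ ≤ 1) (hβ'' : 0 ≤ β'') (hβ : β'' ≤ β') (ha₀ : a₀ ≤ 1 / 2)
    (hsmall : 2 * ((Δ : ℝ) + 1) ^ 2 * θ ^ (β' - β'') * Real.exp a₀ ≤ a₀)
    {w : Finset ι → ℂ} (hz0 : ∀ X ∈ polysOf W, ¬ IsRConnected adj X → w X = 0) (hz : ∀ X ∈ polysOf W, ‖w X‖ ≤ θ ^ (β' * (X.card : ℝ)))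
    {wQ : Finset ι → ℂ} {c : S → ℝ} (hc : ∀ j, 0 ≤ c j)
    (hobs : ∀ X ∈ obsPolys W loc K, ‖wQ X‖ ≤ (∏ j ∈ slotsIn loc K X, c j) * θ ^ (β' * ((X \ (slotsIn loc K X).image loc).card : ℝ)))
    (X' : Finset (ι ⊕ (Finset ι × Finset ι))) :
    ‖Gk (cvsupp adj W) (cvsupp adj W) (slotsIn loc K) (locv1 loc) K (obsPolys W loc K) wQ (Ov (cvsupp adj W)) w (polysOf W) X'‖ ≤
      (Real.exp (2 * a₀ * (X'.filter fun v => v.isLeft).card) *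
          (((obsPolys W loc K).powerset.filter fun D => (∀ X ∈ D, ∀ X₂ ∈ D, X ≠ X₂ → Disjoint (cvsupp adj W X) (cvsupp adj W X₂)) ∧
              D.biUnion (slotsIn loc K) = obsIn (locv1 loc) K X' ∧ dsupp (cvsupp adj W) D ⊆ X').card : ℝ)) *
        θ ^ (β'' * (((X'.filter fun v => v.isLeft) \ K.image (locv loc)).card : ℝ)) * ∏ j ∈ obsIn (locv1 loc) K X', c j := by
  -- Step 1: gen 12's `norm_Gk_le` with `ε := θ^{β′}`, `λ := β″·log(1/θ)`
  have hlog : Real.log θ ≤ 0 := Real.log_nonpos hθ0.le hθ1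
  have hlam : 0 ≤ -(β'' * Real.log θ) := by nlinarith [mul_nonneg hβ'' (neg_nonneg.2 hlog)]
  have hsmall' : 2 * ((Δ : ℝ) + 1) ^ 2 * θ ^ β' * Real.exp (a₀ + -(β'' * Real.log θ)) ≤ a₀ := by
    calc 2 * ((Δ : ℝ) + 1) ^ 2 * θ ^ β' * Real.exp (a₀ + -(β'' * Real.log θ))
        = 2 * ((Δ : ℝ) + 1) ^ 2 * (θ ^ β' * Real.exp (a₀ + -(β'' * Real.log θ))) := by ring
      _ = 2 * ((Δ : ℝ) + 1) ^ 2 * θ ^ (β' - β'') * Real.exp a₀ := by rw [rpow_mul_exp_add_eq hθ0]; ring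
      _ ≤ a₀ := hsmall
  have hz' : ∀ X ∈ polysOf W, ‖w X‖ ≤ (θ ^ β') ^ X.card := fun X hX => by
    rw [← Real.rpow_natCast, ← Real.rpow_mul hθ0.le]; exact hz X hX
  have h := norm_Gk_le (loc := loc) (K := K) hR hΔ hnbr (Real.rpow_nonneg hθ0.le β') hlam ha₀ hsmall' hz0 hz' wQ X'
  simp only [exp_neg_mul_eq_rpow hθ0] at h
  refine h.trans ?_
  -- Step 2: termwise in the admissible decorated families
  set T : Finset (ι ⊕ (Finset ι × Finset ι)) := X'.filter fun v => v.isLeft with hT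
  set 𝒟 : Finset (Finset (Finset ι)) := (obsPolys W loc K).powerset.filter fun D =>
    (∀ X ∈ D, ∀ X₂ ∈ D, X ≠ X₂ → Disjoint (cvsupp adj W X) (cvsupp adj W X₂)) ∧
      D.biUnion (slotsIn loc K) = obsIn (locv1 loc) K X' ∧ dsupp (cvsupp adj W) D ⊆ X' with h𝒟
  set Cobs : ℝ := ∏ j ∈ obsIn (locv1 loc) K X', c j with hCobs
  set nf : ℝ := ((T \ K.image (locv loc)).card : ℝ) with hnf
  have hCobs0 : 0 ≤ Cobs := prod_nonneg fun j _ => hc j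
  have hterm : ∀ D ∈ 𝒟, (∏ X ∈ D, ‖wQ X‖) * θ ^ (β'' * (((X' \ dsupp (cvsupp adj W) D) ∩ T).card : ℝ)) ≤ θ ^ (β'' * nf) * Cobs := by
    intro D hD
    obtain ⟨hDQ, hdisj, hcov, -⟩ := mem_filter.1 hD
    have hDQ' : D ⊆ obsPolys W loc K := mem_powerset.1 hDQ
    -- the observable factors: `Π‖wQ‖ ≤ (Π_{j∈obsIn} c_j) · θ^{β′ M}`, `M = Σ_{X∈D} |X∖H(X)|`
    have h1 : ∏ X ∈ D, ‖wQ X‖ ≤ Cobs * θ ^ (β' * ∑ X ∈ D, ((X \ (slotsIn loc K X).image loc).card : ℝ)) := by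
      calc ∏ X ∈ D, ‖wQ X‖
          ≤ ∏ X ∈ D, ((∏ j ∈ slotsIn loc K X, c j) * θ ^ (β' * ((X \ (slotsIn loc K X).image loc).card : ℝ))) :=
            prod_le_prod (fun _ _ => norm_nonneg _) fun X hX => hobs X (hDQ' hX)
        _ = Cobs * θ ^ (β' * ∑ X ∈ D, ((X \ (slotsIn loc K X).image loc).card : ℝ)) := by
            rw [prod_mul_distrib, prod_prod_slotsIn_eq hdisj hcov, mul_sum, Real.rpow_sum_of_pos hθ0]
    -- trading `β′` for `β″` and collecting the exponents
    have hM : (0 : ℝ) ≤ ∑ X ∈ D, ((X \ (slotsIn loc K X).image loc).card : ℝ) := sum_nonneg fun X _ => Nat.cast_nonneg _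
    have h2 : θ ^ (β' * ∑ X ∈ D, ((X \ (slotsIn loc K X).image loc).card : ℝ)) ≤
        θ ^ (β'' * ∑ X ∈ D, ((X \ (slotsIn loc K X).image loc).card : ℝ)) :=
      Real.rpow_le_rpow_of_exponent_ge hθ0 hθ1 (mul_le_mul_of_nonneg_right hβ hM)
    have hfree : nf ≤ (((X' \ dsupp (cvsupp adj W) D) ∩ T).card : ℝ) + ∑ X ∈ D, ((X \ (slotsIn loc K X).image loc).card : ℝ) := by
      rw [hnf, hT]
      exact_mod_cast card_free_le (adj := adj) (W := W) (loc := loc) (K := K) D X'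
    have h3 : θ ^ (β'' * ∑ X ∈ D, ((X \ (slotsIn loc K X).image loc).card : ℝ)) * θ ^ (β'' * (((X' \ dsupp (cvsupp adj W) D) ∩ T).card : ℝ)) ≤
        θ ^ (β'' * nf) := by
      rw [← Real.rpow_add hθ0]
      exact Real.rpow_le_rpow_of_exponent_ge hθ0 hθ1 (by nlinarith)
    calc (∏ X ∈ D, ‖wQ X‖) * θ ^ (β'' * (((X' \ dsupp (cvsupp adj W) D) ∩ T).card : ℝ))
        ≤ (Cobs * θ ^ (β'' * ∑ X ∈ D, ((X \ (slotsIn loc K X).image loc).card : ℝ))) *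
            θ ^ (β'' * (((X' \ dsupp (cvsupp adj W) D) ∩ T).card : ℝ)) := by
          refine mul_le_mul_of_nonneg_right (h1.trans ?_) (Real.rpow_nonneg hθ0.le _)
          exact mul_le_mul_of_nonneg_left h2 hCobs0
      _ = Cobs * (θ ^ (β'' * ∑ X ∈ D, ((X \ (slotsIn loc K X).image loc).card : ℝ)) *
            θ ^ (β'' * (((X' \ dsupp (cvsupp adj W) D) ∩ T).card : ℝ))) := by ring
      _ ≤ Cobs * θ ^ (β'' * nf) := mul_le_mul_of_nonneg_left h3 hCobs0
      _ = θ ^ (β'' * nf) * Cobs := mul_comm _ _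
  have hexp0 : 0 ≤ Real.exp (2 * a₀ * (T.card : ℝ)) := (Real.exp_pos _).le
  calc Real.exp (2 * a₀ * (T.card : ℝ)) * ∑ D ∈ 𝒟, (∏ X ∈ D, ‖wQ X‖) * θ ^ (β'' * (((X' \ dsupp (cvsupp adj W) D) ∩ T).card : ℝ))
      ≤ Real.exp (2 * a₀ * (T.card : ℝ)) * ∑ _D ∈ 𝒟, θ ^ (β'' * nf) * Cobs := mul_le_mul_of_nonneg_left (sum_le_sum hterm) hexp0
    _ = Real.exp (2 * a₀ * (T.card : ℝ)) * (𝒟.card : ℝ) * θ ^ (β'' * nf) * Cobs := by rw [sum_const, nsmul_eq_mul]; ring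

end Main

/-! ## §3 As an instance of the typed leaf `Ineq312`

`BIJ88Sect5StatementsPart2.PolymerSys.Poly` lives in `Type` (so does `cubeSys`); so do the statements mentioning the leaf. -/

section Leaf

variable {ι : Type} [DecidableEq ι] [Fintype ι] {S : Type} [DecidableEq S] {adj : ι → ι → Prop} [DecidableRel adj] {nbr : ι → Finset ι}
  {Δ : ℕ} {W : Finset ι} {loc : S → ι} {K : Finset S}

/-- **THE TYPED LEAF `Ineq312` INSTANTIATED for the gas of (5.14.3)**: `Ineq312 (cubeSys (ι ⊕ (Finset ι × Finset ι))) Gk cF obsProd nfree θ β″` with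
`Gk X′ := ‖G_k(X′)‖` (gen 11's `BIJ88ObservableFactorization312.Gk` of the (5.14.3) gas), `cF X′ := e^{2a₀#T(X′)}·N_D(X′)`,
`obsProd X′ := Π_{j∈obsIn X′} c_j`, `nfree X′ := #(T(X′) ∖ slot cubes)` (*"|X∖∪X_c|"*), exponent `β″`, under the hypotheses of `norm_Gk_le_printed`.
[cite: BalabanImbrieJaffe1988, (5.14.5) p.312] -/
theorem ineq312_instance (hR : ∀ x y, adj x y → adj y x) (hΔ : ∀ x, (nbr x).card ≤ Δ) (hnbr : ∀ x y, adj x y → y ∈ nbr x)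
    {θ β' β'' a₀ : ℝ} (hθ0 : 0 < θ) (hθ1 : θ ≤ 1) (hβ'' : 0 ≤ β'') (hβ : β'' ≤ β') (ha₀ : a₀ ≤ 1 / 2)
    (hsmall : 2 * ((Δ : ℝ) + 1) ^ 2 * θ ^ (β' - β'') * Real.exp a₀ ≤ a₀)
    {w : Finset ι → ℂ} (hz0 : ∀ X ∈ polysOf W, ¬ IsRConnected adj X → w X = 0) (hz : ∀ X ∈ polysOf W, ‖w X‖ ≤ θ ^ (β' * (X.card : ℝ)))
    {wQ : Finset ι → ℂ} {c : S → ℝ} (hc : ∀ j, 0 ≤ c j)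
    (hobs : ∀ X ∈ obsPolys W loc K, ‖wQ X‖ ≤ (∏ j ∈ slotsIn loc K X, c j) * θ ^ (β' * ((X \ (slotsIn loc K X).image loc).card : ℝ))) :
    BIJ88Sect5StatementsPart4.Ineq312 (cubeSys (ι ⊕ (Finset ι × Finset ι)))
      (fun X' : Finset (ι ⊕ (Finset ι × Finset ι)) =>
        ‖Gk (cvsupp adj W) (cvsupp adj W) (slotsIn loc K) (locv1 loc) K (obsPolys W loc K) wQ (Ov (cvsupp adj W)) w (polysOf W) X'‖)
      (fun X' : Finset (ι ⊕ (Finset ι × Finset ι)) => Real.exp (2 * a₀ * (X'.filter fun v => v.isLeft).card) *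
        (((obsPolys W loc K).powerset.filter fun D => (∀ X ∈ D, ∀ X₂ ∈ D, X ≠ X₂ → Disjoint (cvsupp adj W X) (cvsupp adj W X₂)) ∧
            D.biUnion (slotsIn loc K) = obsIn (locv1 loc) K X' ∧ dsupp (cvsupp adj W) D ⊆ X').card : ℝ))
      (fun X' : Finset (ι ⊕ (Finset ι × Finset ι)) => ∏ j ∈ obsIn (locv1 loc) K X', c j)
      (fun X' : Finset (ι ⊕ (Finset ι × Finset ι)) => ((X'.filter fun v => v.isLeft) \ K.image (locv loc)).card) θ β'' := by
  intro X'
  rw [abs_norm]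
  exact norm_Gk_le_printed hR hΔ hnbr hθ0 hθ1 hβ'' hβ ha₀ hsmall hz0 hz hc hobs X'

/-- **… WITH EVERY INPUT FROM THE TYPED LEAF (5.14.4)** for REAL corner data `zr` (vacuum `g₃′(∅,·)`, observables `g₃′(H(X), X)`): `Ineq5144` gives
`‖g₃′(H, X)‖ ≤ θ^{#H + β′|X∖H|} = (Π_{j∈H} θ)·θ^{β′|X∖H|}`, so the instance holds with the observable constants `c_j = θ` — in the currency of (5.14.4)
a slot is a `d/dt`-derivative and carries a SMALL factor (p. 309), whereas for the observables of p. 312 the print has the LARGE `c(L^kε)^{−m(c)}e^{−m′(c)}`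
(HONEST SCOPE (b) of the header). [cite: BalabanImbrieJaffe1988, (5.14.4) p.309, (5.14.5) p.312] -/
theorem ineq312_of_ineq5144 (hR : ∀ x y, adj x y → adj y x) (hΔ : ∀ x, (nbr x).card ≤ Δ) (hnbr : ∀ x y, adj x y → y ∈ nbr x)
    {θ β' β'' a₀ : ℝ} (hθ0 : 0 < θ) (hθ1 : θ ≤ 1) (hβ'' : 0 ≤ β'') (hβ : β'' ≤ β') (ha₀ : a₀ ≤ 1 / 2)
    (hsmall : 2 * ((Δ : ℝ) + 1) ^ 2 * θ ^ (β' - β'') * Real.exp a₀ ≤ a₀) {zr : Finset S → Finset ι → Finset ι → ℝ}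
    (h : BIJ88Sect5StatementsPart2.Ineq5144 (cubeSys ι) (Finset S) (prime (g3 adj zr)) Finset.card
      (fun H (X : Finset ι) => (X \ H.image loc).card) θ β') :
    BIJ88Sect5StatementsPart4.Ineq312 (cubeSys (ι ⊕ (Finset ι × Finset ι)))
      (fun X' : Finset (ι ⊕ (Finset ι × Finset ι)) =>
        ‖Gk (cvsupp adj W) (cvsupp adj W) (slotsIn loc K) (locv1 loc) K (obsPolys W loc K)
          (fun X => prime (g3 adj fun K X Λ => ((zr K X Λ : ℝ) : ℂ)) (slotsIn loc K X) X) (Ov (cvsupp adj W))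
          (fun X => prime (g3 adj fun K X Λ => ((zr K X Λ : ℝ) : ℂ)) ∅ X) (polysOf W) X'‖)
      (fun X' : Finset (ι ⊕ (Finset ι × Finset ι)) => Real.exp (2 * a₀ * (X'.filter fun v => v.isLeft).card) *
        (((obsPolys W loc K).powerset.filter fun D => (∀ X ∈ D, ∀ X₂ ∈ D, X ≠ X₂ → Disjoint (cvsupp adj W X) (cvsupp adj W X₂)) ∧
            D.biUnion (slotsIn loc K) = obsIn (locv1 loc) K X' ∧ dsupp (cvsupp adj W) D ⊆ X').card : ℝ))
      (fun X' : Finset (ι ⊕ (Finset ι × Finset ι)) => ∏ _j ∈ obsIn (locv1 loc) K X', θ)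
      (fun X' : Finset (ι ⊕ (Finset ι × Finset ι)) => ((X'.filter fun v => v.isLeft) \ K.image (locv loc)).card) θ β'' := by
  refine ineq312_instance hR hΔ hnbr hθ0 hθ1 hβ'' hβ ha₀ hsmall (fun X hX hc => ?_) (fun X _ => norm5144_of_ineq5144 h X)
    (fun _ => hθ0.le) fun X _ => ?_
  · by_contra hne
    exact hc (isRConnected_of_prime_g3_ne_zero hR _ ∅ (mem_polysOf.1 hX).2 hne)
  · rw [prod_const, ← Real.rpow_natCast, ← Real.rpow_add hθ0]
    exact norm_prime_g3_le_of_ineq5144 h (slotsIn loc K X) X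

end Leaf

end Literature.MathematicalPhysics.QuantumFieldTheory.BalabanImbrieJaffe1984to88.BIJ88Ineq312Instance
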